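import Summits.CriticalPhenomena.SAWScalingLimit.Theorems.SAWLeftRightFKGFKGToTraversalBoundGatesDefs
import Literature.Probability.Percolation.InterfaceTraversalBound
import HarnessLib

/-!
# The `δ`-uniform forced allowance of the lattice Kemppainen–Smirnov iteration: boundary-tainted sectors are few
(crux `SAWLeftRightFKG.FKGToTraversalBound`, stmt-CriticalPhenomena-1878; line `gates-by-bubble-doors-by-fkg`,
registered helper `stub_taintedSectorBound` of STUB 5 `stub_shellIteration`)

STUB 5 (`SAWCollarBound → GoodShellTight`) is the Kemppainen–Smirnov iteration (Ann. Probab. 45 (2017), Prop. 3.5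
/ Lemma 3.6) run ON THE LATTICE: crossings of a shell `D(x; r₁, r₂)` by the critical chord are either UNFORCED (they
enter a dead end of the current slit carrier — charged by the collar bound) or FORCED.  The per-shell threshold of
`ShellTightOn` may depend on the shell and on the Jordan domain `D` but NOT on the mesh `δ`, so the iteration needs a
`δ`-UNIFORM allowance for the crossings that the BOUNDARY forces.  The sub-goal H4 of the chart asked for a
`δ`-uniform bound on all forced crossings; that is false dynamically (a chord's own past forces `≍ ρ/δ` crossings:
interleaved combs tuned to the two rims, `work/stubs/scratch_shellIteration/combs.py` of the lead folder — min over
all continuations `= 4s - 1` at scale `s = 1/δ`), and what survives is the STATIC, boundary part, in the form the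
Aizenman–Burchard sector argument uses (Duke Math. J. 99 (1999), App. A; the tree's percolation and Ising instances
`Percolation.card_le_of_separated_frontier_points`, `LatticeModels.plusArmsAvoiding_of_hasTraversals`):

* `card_le_of_separated_nearFrontier_points` — for a Jordan domain with boundary modulus `θ` at scale `η`, points
  OF THE DOMAIN lying in pairwise distinct components of `(B(x,r₂) ∖ B̄(x,r₁)) ∖ K` (`K` any set missing `∂D`: the
  mesh polyline of the past, of the whole chord, of several chords) and each joined to a NON-domain point by a
  straight segment inside the middle ring `r₁ + η ≤ |· - x| ≤ r₂ - η` and off `K` — the situation of a lattice site of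
  a sector adjacent to a non-domain site — number at most `⌊1/θ⌋₊ + 1`: the segment meets `∂D` (the domain is open,
  the segment connected) at a point of the same component, and the tree's frontier-point count applies;
* `stub_taintedSectorBound` (registered, def-free) — hence for every Dobrushin domain `D` and margin `η > 0` there is
  `N = N(D, η)` bounding such families for ALL centres, radii and cut sets `K` at once: uniform in the shell (given
  the margin), in the mesh and in the walk.  This is the allowance `n₀` of the iteration for every shell of the
  averaging window simultaneously (KS17 need "the domain smooth, otherwise `n₀` would not be bounded" because they
  bound it for all shells at once; per shell-with-margin, uniform continuity of the boundary loop suffices);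
* `shellTightOn_of_subshell` — the glue that makes a `δ`-DEPENDENT choice of the observed sub-shell legitimate in
  `ShellTightOn`: separate traversals of `D(x; ρ, R)` are separate traversals of every nested `D(x; ρ', R')`
  (`Curve.HasTraversals.mono'`), so a threshold `n` that works at mesh `δ` for SOME sub-shell `ρ ≤ ρ' , R' ≤ R`
  (the generic member of an averaging window, away from the `O(δ)`-thin set of rims to which the past is tuned)
  works for `D(x; ρ, R)` itself.

References: M. Aizenman, A. Burchard, Duke Math. J. 99 (1999) App. A; A. Kemppainen, S. Smirnov, Ann. Probab. 45
(2017) §3.2 (proof of Prop. 3.5: the number `n₀`).  Only theorems; no named fact; standard axioms.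
-/

noncomputable section

open MeasureTheory Set Metric
open scoped ENNReal
open Literature.Probability.LatticeModels
open Literature.Probability.RandomPlanarGeometry
open Literature.Probability.RandomPlanarGeometry.SAW

namespace Summit.CriticalPhenomena.SAWScalingLimit.Theorems.FKGToTraversalBound.GatesByBubbleDoorsByFKG

/-- A preconnected set of the plane meeting an open set `Ω` and its complement meets `∂Ω` (`Ω` and `(closure Ω)ᶜ`
are disjoint open sets).  [folklore] -/
-- adapted from `Literature.Probability.LatticeModels.inter_frontier_nonempty_of_isPreconnected`
theorem inter_frontier_nonempty_of_isPreconnected' {Ω c : Set ℂ} (hΩ : IsOpen Ω) (hc : IsPreconnected c)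
    (h1 : (c ∩ Ω).Nonempty) (h2 : (c ∩ Ωᶜ).Nonempty) : (c ∩ frontier Ω).Nonempty := by
  by_contra h
  rw [not_nonempty_iff_eq_empty] at h
  have hsub : c ⊆ Ω ∪ (closure Ω)ᶜ := by
    intro z hz
    by_cases hz1 : z ∈ closure Ω
    · rw [closure_eq_self_union_frontier] at hz1
      rcases hz1 with h' | h'
      · exact Or.inl h'
      · have : z ∈ c ∩ frontier Ω := ⟨hz, h'⟩
        rw [h] at this
        exact this.elim
    · exact Or.inr hz1
  have hdisj : Disjoint Ω (closure Ω)ᶜ := disjoint_left.2 fun z hz hz' => hz' (subset_closure hz)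
  rcases hc.subset_or_subset hΩ isClosed_closure.isOpen_compl hdisj hsub with h' | h'
  · obtain ⟨z, hz, hz'⟩ := h2
    exact hz' (h' hz)
  · obtain ⟨z, hz, hz'⟩ := h1
    exact (h' hz) (subset_closure hz')

/-- **Near-boundary points in separated components of an annulus are few.**  Let `θ > 0` be a modulus of the
boundary loop of the Jordan domain `D` at scale `η` (`|s - t| < θ ⇒ |b(s) - b(t)| < η`) and let `K` miss `∂D`.
Points of `D` lying in pairwise distinct connected components of `(B(x, r₂) ∖ B̄(x, r₁)) ∖ K`, each joined to a
point outside `D` by a segment contained in the middle ring `r₁ + η ≤ |· - x| ≤ r₂ - η` and disjoint from `K`,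
number at most `⌊1/θ⌋₊ + 1`: each segment meets `∂D` at a point of the same component (the ring lies in the open
annulus as `η > 0`), distinct points give distinct boundary points, and
`Percolation.card_le_of_separated_frontier_points` counts those. [cite: AizenmanBurchardDuke1999, Appendix A] -/
theorem card_le_of_separated_nearFrontier_points (Dj : JordanDomain) {x : ℂ} {r₁ r₂ η θ : ℝ} (hη : 0 < η)
    (hθ : 0 < θ) (hmod : ∀ s t : ℝ, |s - t| < θ → dist (Dj.boundary s) (Dj.boundary t) < η)
    {K : Set ℂ} (hK : Disjoint K (frontier Dj.carrier)) (S : Finset ℂ)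
    (hS : ∀ z ∈ S, z ∈ Dj.carrier ∧ ∃ u : ℂ, u ∉ Dj.carrier ∧
      segment ℝ z u ⊆ {w : ℂ | r₁ + η ≤ dist w x ∧ dist w x ≤ r₂ - η} ∧ Disjoint (segment ℝ z u) K)
    (hsep : ∀ z ∈ S, ∀ z' ∈ S, z ≠ z' →
      connectedComponentIn ((ball x r₂ \ closedBall x r₁) \ K) z ≠
        connectedComponentIn ((ball x r₂ \ closedBall x r₁) \ K) z') :
    S.card ≤ ⌊1 / θ⌋₊ + 1 := by
  classical
  set F : Set ℂ := (ball x r₂ \ closedBall x r₁) \ K with hF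
  -- the boundary point on each segment
  have hfront : ∀ z ∈ S, ∃ w : ℂ, w ∈ frontier Dj.carrier ∧ (r₁ + η ≤ dist w x ∧ dist w x ≤ r₂ - η) ∧
      w ∈ connectedComponentIn F z := by
    intro z hz
    obtain ⟨hzD, u, huD, hring, hsegK⟩ := hS z hz
    have hconn : IsPreconnected (segment ℝ z u) := (convex_segment z u).isPreconnected
    obtain ⟨w, hwseg, hwfr⟩ := inter_frontier_nonempty_of_isPreconnected' Dj.isOpen hconn
      ⟨z, left_mem_segment ℝ z u, hzD⟩ ⟨u, right_mem_segment ℝ z u, huD⟩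
    have hsegF : segment ℝ z u ⊆ F := by
      intro w' hw'
      obtain ⟨h1, h2⟩ := hring hw'
      refine ⟨⟨?_, ?_⟩, fun hw'K => Set.disjoint_left.1 hsegK hw' hw'K⟩
      · rw [mem_ball]; linarith
      · rw [mem_closedBall, not_le]; linarith
    exact ⟨w, hwfr, hring hwseg, hconn.subset_connectedComponentIn (left_mem_segment ℝ z u) hsegF hwseg⟩
  choose! f hf using hfront
  -- `f` is injective on `S`
  have hinj : Set.InjOn f S := by
    intro z hz z' hz' hzz'
    by_contra hne
    apply hsep z hz z' hz' hne
    rw [connectedComponentIn_eq (hf z hz).2.2, connectedComponentIn_eq (hf z' hz').2.2, hzz']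
  -- count the boundary points
  have hcard := Literature.Probability.Percolation.card_le_of_separated_frontier_points Dj (x := x) (r₁ := r₁)
    (r₂ := r₂) (η := η) hθ hmod hK (S.image f) (fun w hw => ?_) (fun w hw w' hw' hww' => ?_)
  · rwa [Finset.card_image_of_injOn hinj] at hcard
  · obtain ⟨z, hz, rfl⟩ := Finset.mem_image.1 hw
    exact ⟨(hf z hz).1, (hf z hz).2.1⟩
  · obtain ⟨z, hz, rfl⟩ := Finset.mem_image.1 hw
    obtain ⟨z', hz', rfl⟩ := Finset.mem_image.1 hw'
    have hne : z ≠ z' := fun h => hww' (h ▸ rfl)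
    rw [← connectedComponentIn_eq (hf z hz).2.2, ← connectedComponentIn_eq (hf z' hz').2.2]
    exact hsep z hz z' hz' hne

/-- **Registered helper `stub_taintedSectorBound` of STUB 5 (the `δ`-uniform boundary-forced allowance).**  For every
Dobrushin domain `D` and margin `η > 0` there is `N = N(D, η)` such that for EVERY centre `x`, radii `r₁, r₂`, cut set
`K` missing `∂D` (e.g. the mesh polyline of a chord or of its past) and finite set `S` of points of the domain lying in
pairwise distinct components of `(B(x, r₂) ∖ B̄(x, r₁)) ∖ K`, each joined to a non-domain point by a segment inside the
middle ring `r₁ + η ≤ |· - x| ≤ r₂ - η` and off `K`, one has `#S ≤ N`: at most `N` sectors of an annulus cut by a walk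
are forced by the boundary, uniformly in the shell (given the margin), the mesh and the walk
(`card_le_of_separated_nearFrontier_points` with a boundary modulus `θ(η)` from
`Percolation.JordanDomain.exists_modulus`). [cite: AizenmanBurchardDuke1999, Appendix A] -/
theorem stub_taintedSectorBound : ∀ (D : DobrushinDomain) (η : ℝ), 0 < η → ∃ N : ℕ, ∀ (x : ℂ) (r₁ r₂ : ℝ) (K : Set ℂ) (S : Finset ℂ), Disjoint K (frontier D.carrier) → (∀ z ∈ S, z ∈ D.carrier ∧ ∃ u : ℂ, u ∉ D.carrier ∧ segment ℝ z u ⊆ {w : ℂ | r₁ + η ≤ dist w x ∧ dist w x ≤ r₂ - η} ∧ Disjoint (segment ℝ z u) K) → (∀ z ∈ S, ∀ z' ∈ S, z ≠ z' → connectedComponentIn ((Metric.ball x r₂ \ Metric.closedBall x r₁) \ K) z ≠ connectedComponentIn ((Metric.ball x r₂ \ Metric.closedBall x r₁) \ K) z') → S.card ≤ N := by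
  intro D η hη
  obtain ⟨θ, hθ, hmod⟩ := Literature.Probability.Percolation.JordanDomain.exists_modulus D.toJordanDomain hη
  exact ⟨⌊1 / θ⌋₊ + 1, fun x r₁ r₂ K S hK hS hsep =>
    card_le_of_separated_nearFrontier_points D.toJordanDomain hη hθ hmod hK S hS hsep⟩

/-- **Sub-shell glue.**  Per-shell tightness on a mesh class follows as soon as, for each shell `D(x; ρ, R)` and
`ε > 0`, ONE threshold `n` bounds — at every small mesh `δ` of the class — the probability of `n` separate traversals
of SOME sub-shell `D(x; ρ', R')`, `ρ ≤ ρ'`, `R' ≤ R`, which may depend on `δ`: traversals of the shell are traversals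
of each nested sub-shell (`Curve.HasTraversals.mono'`), so the event only grows. [cite: AizenmanBurchardDuke1999, §3.a] -/
theorem shellTightOn_of_subshell {P : ℝ → Prop} {M : ℝ} {D : DobrushinDomain} {a b : ℝ → Site 2}
    (h : ∃ δ₀ : ℝ, 0 < δ₀ ∧ ∀ (x : ℂ) (ρ R : ℝ), 0 < ρ → M * ρ ≤ R → R ≤ 1 → ∀ ε : ℝ, 0 < ε → ∃ n : ℕ,
      ∀ δ ∈ Set.Ioc (0 : ℝ) δ₀, δ ≤ ρ → P δ → ∃ ρ' R' : ℝ, ρ ≤ ρ' ∧ R' ≤ R ∧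
        law D.carrier δ (a δ) (b δ)
            {γ | (⟨γ.walk.toCurve (meshPoint δ)⟩ : Curve ℂ).HasTraversals n x ρ' R'} ≤ ENNReal.ofReal ε) :
    ShellTightOn P M D a b := by
  obtain ⟨δ₀, hδ₀, H⟩ := h
  refine ⟨δ₀, hδ₀, fun x ρ R hρ hMR hR1 ε hε => ?_⟩
  obtain ⟨n, hn⟩ := H x ρ R hρ hMR hR1 ε hε
  refine ⟨n, fun δ hδ hδρ hP => ?_⟩
  obtain ⟨ρ', R', hρρ', hR'R, hlaw⟩ := hn δ hδ hδρ hP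
  refine le_trans (measure_mono fun γ hγ => ?_) hlaw
  exact Curve.HasTraversals.mono' hγ hρρ' hR'R

end Summit.CriticalPhenomena.SAWScalingLimit.Theorems.FKGToTraversalBound.GatesByBubbleDoorsByFKG

end
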